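import Summits.QuantumFields.YangMills.Theorems.BalabanUVNodesN22WindowSoftTwoPointAtSlotsInhabited
import Summits.QuantumFields.YangMills.Theorems.BalabanUVNodesN22W1CouplingRadiiPhaseTower
import Literature.MathematicalPhysics.QuantumFieldTheory.Balaban1983to89.B14Eq22Determines
import Literature.MathematicalPhysics.QuantumFieldTheory.Balaban1983to89.B15DeterminingSets
import Mathlib.Analysis.SpecialFunctions.Trigonometric.Bounds

/-!
# NODE N22 (NE9) — A6, NEXT RUNG (part 1∕2, THE MODEL): a NON-DEGENERATE U(1) MODEL STEP for (A)'s activity-level capstones —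
# configuration- AND history-dependent activities, W1's two slots on it, an honest (injective) complexification whose site weights ARE the p. 282 tails,
# the chart∕space clauses of the complexified reading at the NON-ZERO probe chart `x ↦ ix`

Cell `pub-ymgap`, Track A (HUMAN RULING D-0062), WIDTH SEAT `dag-n22-w2` (g4) on node n22 = NE9; `--kind proof --supports stmt-QuantumFields-20544 --as helper`
(K3⁷ `SpineGivenEndpointR13SepCoPH`), COUNT-NEUTRAL; THEOREMS ONLY (0 `def`, 0 `sorry`, standard axioms).  TRIGGER: referee ref-F g20 READ-497 (pub-ymgap INBOX l.30687) on this
lineage's zero-chart smoke test p602050 (g2 `…N22WindowSoftTwoPointInhabited`; same pattern in g3's (C) p607185 `…AtSlotsInhabited`): PASS, with NOTE-1 «at the zero chart the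
CONCLUSIONS are free — the smoke test certifies hypothesis-shape satisfiability + elaboration and cannot tell a capstone with content from one without; a NON-zero chart witness
would be A6's next rung».  This file and its sequel `…AtSlotsNonzeroChart` (part 2∕2: the capstones FIRE) deliver that rung.

WHY A NEW MODEL.  At the zero chart `ρ = 0` every `polWindow` vanishes (`Record8Inhabited.polWindow_zeroChart`), so `WindowedNE9`∕`WindowedDecay` hold for free; at the EMPTY towers
(p607185) or at CONFIGURATION-CONSTANT activities (dag-n22-w1's phase tower p611030, declared there) the localized sum does not read the probe at all, so again the letters are
free.  A witness where the conclusion has content needs ALL THREE: a non-zero chart, a reading that is non-constant in the probe field, and activities that read the configuration.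
THE MODEL (every object explicit; `𝔸 := ℂ`, probe space `V := ℝ`, basis `Basis.singleton`): on Bałaban's torus catalogue `𝐃_{k+1}` of the `K`-th torus (def-T's `Sect2.domSys`), ONE
term per polymer `Z`,
  `H(Z; g; φ) = A e^{−R d_{k+1}(Z)} · e^{iΣ_{i≤k} g_i ω^{k+1−i}} · (1∕N_{k+1}) Σ_{(l,t)} e^{−r∕w_Z(t̃)} · φ.1⟨embIter (k+1) t, l⟩`   (`t̃ = blockIter (k+1) (embIter (k+1) t)`),
LINEAR and NON-CONSTANT in the configuration `φ = (𝐔, 𝐉)` (it reads `𝐔` at one fine bond over EVERY coarse pair `(l, t)`), with a genuine PHASE in every young coupling (fading with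
its age when `ω < 1`); site weights `w_X(t) = B₃ e^{−δ₀ distCT(cast t, nearT X)}` = the p. 282 TAIL PROFILE ITSELF ([I] p. 282; (A)'s `htail` with equality); admissible spaces
`sp Z = {φ | ∀ b, ‖φ.1 b‖ ≤ e^{r∕w_Z(blockIter (k+1) b.src)}}`; complexification `ι_X B = ((l,t) ↦ B_{l,t}·w_X(t))` into `Fin d → Site_{k+1} → ℂ` (sup norm) — INJECTIVE; complexified
readings `Φ_X z = (b ↦ e^{i z_{b.dir, t_b}∕w_X(t_b)}, 0)`, `t_b = blockIter (k+1) b.src`; chart `ρ x = ix` (`(ContinuousLinearMap.id ℝ ℝ).smulRight I`; `exp ρB = e^{iB} ∈ U(1)`); reading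
`emb K k W = (b ↦ W_{b.dir}(blockIter (k+1) b.src), 0)` (the coarse probe field PULLED BACK to the fine bonds by [I]'s iterated block map — `B14.Eq22Determines.blockIter`).

WHAT (this part).  §1 scalar lemmas (`‖e^{ix} − e^{iy}‖ ≤ |x − y|`, `‖e^{iz∕w}‖ ≤ e^{r∕w}` on `‖z‖ ≤ r`, averages of sub-unit terms).  §2 the tail weight is positive and MONOTONE in the
domain (`Z ⊆ X ⇒ w_Z ≤ w_X`: `nearT_le`∕`nearT_mem`).  §3 at a model step `S` (any `ClusterStep` whose `H` IS the display above — realised in part 2): `norm_readout_le_one`; ★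
`bound238_u1Step` (W1's `Bound238 … A R` on ANY prefix set — (2.38)'s shape, [II] p. 20); ★ `youngLipschitz_u1Step` (W1's `YoungLipschitz` with the FADING moduli `A ω^{k+1−i}` — the
differenced slot is NOT PRINTED, [I] p. 263); ★ `differentiableOn_H_comp_Φ` ((A)'s `hHhol`); `Φ_mem_sp` ((A)'s `hΦsp` on the ball `‖z‖ < r`, by §2's monotonicity); `ι_injective`;
`Φ_ι_eq` ((A)'s chart clause `Φ_X (ι_X B) = emb (e^{iB})`); `norm_ι_single_le` ((A)'s `hw`); NON-DEGENERACY CERTIFICATES `H_zero_config` (`H(Z;g;0) = 0`), `norm_H_one_config_pos`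
(`‖H(Z;g;𝟙)‖ > 0`), `H_update` (`H(Z; g|g_i:=s) = H(Z; g|g_i:=0)·e^{isω^{k+1−i}}`).

HONEST FRAMING (binding).  An A6 MODEL WITNESS (abelian toy on Bałaban's torus bookkeeping), count-neutral; it certifies ONLY that (A)'s activity-level antecedent is jointly
satisfiable at a non-zero chart with configuration- and history-dependent activities and a non-constant reading.  It is NOT NODE 00's tower, NOT the minimizer reading `U_{k+1}(e^{iB})`,
NOT print's chart `θ.ρ8`, NOT gauge-covariant, and says NOTHING about the record; nothing of Bałaban's is asserted or constructed; N22∕(D4) NOT discharged (typed 28∕28 · discharged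
5∕27 UNCHANGED); K3⁷ OPEN, NOT claimed; no count claim (the chair's single count line is the only count); no summit statement is proved by this seat; one finite 𝕋⁴ programme at
fixed ε — R4 closes the CONDITIONAL rung `BalabanLadder.UV` only; NOTHING about the continuum limit, ℝ⁴, OS axioms, a mass gap or the Clay problem is proved or claimed by any of
this.  References (TYPES only): [I] = Bałaban, CMP 109 (1987) (0.1) p. 251, (1.7) p. 261, p. 263, (1.20)–(1.21) p. 264, p. 282; [II] = CMP 116 (1988) (2.13)–(2.14) pp. 14–15, (2.38) p. 20.
-/

noncomputable section

open Filter Topology Metric Set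
open scoped BigOperators

namespace YMDAG.N22.WindowSoftTwoPoint.NonzeroChart

open Literature.MathematicalPhysics.QuantumFieldTheory.Balaban1983to89
open Literature.MathematicalPhysics.QuantumFieldTheory.Balaban1983to89.T4Continuum (T4Family)
open Literature.MathematicalPhysics.QuantumFieldTheory.Balaban1983to89.Node00.Sect2 (domCount domSys CPair)
open Literature.MathematicalPhysics.QuantumFieldTheory.Balaban1983to89.Node00.LocalizedSum17 (localizedSum ReadingMaps)
open Literature.MathematicalPhysics.QuantumFieldTheory.Balaban1983to89.Node00.W1 (ClusterTower ClusterStep)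
open Literature.MathematicalPhysics.QuantumFieldTheory.Balaban1983to89.Node00.U3OfKernels (histPrefix)
open Literature.MathematicalPhysics.QuantumFieldTheory.Balaban1983to89.Node00.U3KernelLetters (WindowedNE9 WindowedDecay)
open Literature.MathematicalPhysics.QuantumFieldTheory.Balaban1983to89.B12Decay510 (delta1)
open Literature.MathematicalPhysics.QuantumFieldTheory.Balaban1983to89.B12Decay510Window (K₁)
open Literature.MathematicalPhysics.QuantumFieldTheory.Balaban1983to89.B12Decay510Torus (distCT nearT nearT_mem nearT_le distCT_nonneg)
open Literature.MathematicalPhysics.QuantumFieldTheory.Balaban1983to89.B12TreeDecay (K₀ kappa₀ K₀_pos kappa₀_nonneg)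
open Literature.MathematicalPhysics.QuantumFieldTheory.Balaban1983to89.TreeLengthTorus (TPt TDom)
open Literature.MathematicalPhysics.QuantumFieldTheory.Balaban1983to89.B14.Eq22Determines (blockIter)
open Literature.MathematicalPhysics.QuantumFieldTheory.Balaban1983to89.B15DeterminingSets (embIter)
open YMDAG.N22.W1.CouplingRadii.PhaseTower (norm_cexp_I_mul_ofReal)

/-! ## §1 Scalar lemmas: the phase `e^{ix}` is 1-Lipschitz, the exponential read-out is bounded on a ball, averages of sub-unit terms are sub-unit
(`‖e^{ix}‖ = 1` is dag-n22-w1's `PhaseTower.norm_cexp_I_mul_ofReal`, p611030 — cited, not re-declared) -/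

/-- The phase is 1-Lipschitz: `‖e^{ix} − e^{iy}‖ ≤ |x − y|` (`= 2|sin((x−y)∕2)|`; Mathlib `Real.norm_exp_I_mul_ofReal_sub_one_le`; the same folklore fact is
`cvxr_norm_cexp_sub_cexp_le` in the Hubbard summit tree, not importable here). [folklore] -/
theorem norm_cexp_I_sub_cexp_I_le (x y : ℝ) :
    ‖Complex.exp (Complex.I * (x : ℂ)) - Complex.exp (Complex.I * (y : ℂ))‖ ≤ |x - y| := by
  have h : Complex.exp (Complex.I * (x : ℂ)) - Complex.exp (Complex.I * (y : ℂ)) =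
      Complex.exp (Complex.I * (y : ℂ)) * (Complex.exp (Complex.I * ((x - y : ℝ) : ℂ)) - 1) := by
    rw [mul_sub, mul_one, ← Complex.exp_add, Complex.ofReal_sub]
    congr 1; ring_nf
  rw [h, norm_mul, norm_cexp_I_mul_ofReal, one_mul]
  exact (Real.norm_exp_I_mul_ofReal_sub_one_le (x := x - y)).trans (le_of_eq (Real.norm_eq_abs _))

/-- Differences of weighted sums: `|Σ g_i c_i − Σ g′_i c_i| ≤ Σ c_i |g_i − g′_i|` (`c ≥ 0`). [folklore] -/
theorem abs_sum_mul_sub_sum_mul_le {n : ℕ} (g g' c : Fin n → ℝ) (hc : ∀ i, 0 ≤ c i) :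
    |∑ i, g i * c i - ∑ i, g' i * c i| ≤ ∑ i, c i * |g i - g' i| := by
  rw [← Finset.sum_sub_distrib]
  refine (Finset.abs_sum_le_sum_abs _ _).trans (le_of_eq (Finset.sum_congr rfl fun i _ => ?_))
  rw [← sub_mul, abs_mul, abs_of_nonneg (hc i), mul_comm]

/-- The exponential read-out on a ball: `‖e^{i z ∕ w}‖ ≤ e^{r∕w}` for `‖z‖ ≤ r`, `w > 0`. [folklore] -/
theorem norm_cexp_I_mul_div_le {z : ℂ} {w r : ℝ} (hw : 0 < w) (hz : ‖z‖ ≤ r) :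
    ‖Complex.exp (Complex.I * z / (w : ℂ))‖ ≤ Real.exp (r / w) := by
  rw [Complex.norm_exp, Real.exp_le_exp]
  have h1 : (Complex.I * z / (w : ℂ)).re = -z.im / w := by
    rw [Complex.div_ofReal_re, Complex.I_mul_re, neg_div]
  rw [h1]
  have h2 : -z.im ≤ ‖z‖ := (neg_le_abs z.im).trans (Complex.abs_im_le_norm z)
  exact div_le_div_of_nonneg_right (h2.trans hz) hw.le

/-- An average of terms of norm `≤ 1` has norm `≤ 1` (with `card⁻¹ = 0` on an empty index type). [folklore] -/
theorem norm_invCard_mul_sum_le_one {ι : Type*} [Fintype ι] (f : ι → ℂ) (hf : ∀ i, ‖f i‖ ≤ 1) :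
    ‖((Fintype.card ι : ℂ))⁻¹ * ∑ i, f i‖ ≤ 1 := by
  rw [norm_mul, norm_inv, Complex.norm_natCast]
  have hs : ‖∑ i, f i‖ ≤ (Fintype.card ι : ℝ) := by
    refine (norm_sum_le _ _).trans ?_
    calc ∑ i, ‖f i‖ ≤ ∑ _i : ι, (1 : ℝ) := Finset.sum_le_sum fun i _ => hf i
      _ = (Fintype.card ι : ℝ) := by simp
  exact inv_mul_le_one_of_le₀ hs (Nat.cast_nonneg _)

/-! ## §2 Site weights on the torus catalogue: the p. 282 tail profile is positive and MONOTONE in the domain -/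

/-- The distance from a fine site to the nearest cube of a domain can only DECREASE when the domain grows. [folklore] -/
theorem distCT_nearT_mono {d N M : ℕ} [NeZero N] [NeZero M] (p : TPt d (N * M)) {Z X : TDom d N} (h : Z.1 ⊆ X.1) :
    distCT N M p (nearT (M := M) p X) ≤ distCT N M p (nearT (M := M) p Z) :=
  nearT_le p X (h (nearT_mem p Z))

/-- Hence the tail weight `B₃ e^{−δ₀ dist(p, X)}` is monotone in the domain (`B₃, δ₀ ≥ 0`). [folklore] -/
theorem tailWeight_mono {d N M : ℕ} [NeZero N] [NeZero M] (p : TPt d (N * M)) {Z X : TDom d N} (h : Z.1 ⊆ X.1)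
    {B₃ δ₀ : ℝ} (hB₃ : 0 ≤ B₃) (hδ₀ : 0 ≤ δ₀) :
    B₃ * Real.exp (-δ₀ * distCT N M p (nearT (M := M) p Z)) ≤ B₃ * Real.exp (-δ₀ * distCT N M p (nearT (M := M) p X)) := by
  refine mul_le_mul_of_nonneg_left (Real.exp_le_exp.2 ?_) hB₃
  rw [neg_mul, neg_mul, neg_le_neg_iff]
  exact mul_le_mul_of_nonneg_left (distCT_nearT_mono p h) hδ₀

/-- The tail weight is positive (`B₃ > 0`). [folklore] -/
theorem tailWeight_pos {d N M : ℕ} [NeZero N] [NeZero M] (p : TPt d (N * M)) (X : TDom d N) {B₃ δ₀ : ℝ} (hB₃ : 0 < B₃) :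
    0 < B₃ * Real.exp (-δ₀ * distCT N M p (nearT (M := M) p X)) :=
  mul_pos hB₃ (Real.exp_pos _)

/-! ## §3 The U(1) model STEP: activities `H(Z; g; φ) = A e^{−R d(Z)} · e^{iΣ g_i ω^{k+1−i}} · avg_{(l,t)} e^{−r∕w_Z(t̃)} φ.1⟨embIter t, l⟩`, W1's two slots, the
complexified reading, its chart∕space clauses and site weights -/

section Step

variable {P : Params} {M k : ℕ} (S : ClusterStep P ℂ M k) (wt : (domSys P M (k + 1)).Dom → Site P (k + 1) → ℝ) {A R ω r : ℝ}
variable (hS : ∀ (g : Fin (k + 1) → ℝ) (φ : CPair P ℂ) (Z : (domSys P M (k + 1)).Dom),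
  S.H g φ Z = ((A * Real.exp (-(R * (domSys P M (k + 1)).dj Z)) : ℝ) : ℂ) *
    Complex.exp (Complex.I * ((∑ i : Fin (k + 1), g i * ω ^ (k + 1 - (i : ℕ)) : ℝ) : ℂ)) *
    (((Fintype.card (Fin P.d × Site P (k + 1)) : ℂ))⁻¹ *
      ∑ lt : Fin P.d × Site P (k + 1), ((Real.exp (-(r / wt Z (blockIter (k + 1) (embIter (k + 1) lt.2)))) : ℝ) : ℂ) *
        φ.1 ⟨embIter (k + 1) lt.2, lt.1⟩))

/-- On the model's admissible space `sp Z = {φ | ∀ b, ‖φ.1 b‖ ≤ e^{r∕w_Z(t_b)}}` the normalised read-out has norm `≤ 1`. [folklore] -/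
theorem norm_readout_le_one (Z : (domSys P M (k + 1)).Dom) (φ : CPair P ℂ)
    (hφ : ∀ b : PBond P 0, ‖φ.1 b‖ ≤ Real.exp (r / wt Z (blockIter (k + 1) b.src))) :
    ‖((Fintype.card (Fin P.d × Site P (k + 1)) : ℂ))⁻¹ *
      ∑ lt : Fin P.d × Site P (k + 1), ((Real.exp (-(r / wt Z (blockIter (k + 1) (embIter (k + 1) lt.2)))) : ℝ) : ℂ) *
        φ.1 ⟨embIter (k + 1) lt.2, lt.1⟩‖ ≤ 1 := by
  refine norm_invCard_mul_sum_le_one _ fun lt => ?_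
  rw [norm_mul, Complex.norm_real, Real.norm_eq_abs, abs_of_pos (Real.exp_pos _)]
  have h := hφ ⟨embIter (k + 1) lt.2, lt.1⟩
  calc Real.exp (-(r / wt Z (blockIter (k + 1) (embIter (k + 1) lt.2)))) * ‖φ.1 ⟨embIter (k + 1) lt.2, lt.1⟩‖
      ≤ Real.exp (-(r / wt Z (blockIter (k + 1) (embIter (k + 1) lt.2)))) * Real.exp (r / wt Z (blockIter (k + 1) (embIter (k + 1) lt.2))) :=
        mul_le_mul_of_nonneg_left h (Real.exp_nonneg _)
    _ = 1 := by rw [← Real.exp_add, neg_add_cancel, Real.exp_zero]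

include hS

/-- **THE (2.38) VALUE BOUND AT THE MODEL STEP, pointwise**: `‖H(Z; g; φ)‖ ≤ A e^{−R d_{k+1}(Z)}` on `sp Z` for EVERY real prefix `g` (`A ≥ 0`). [folklore] -/
theorem norm_H_le (hA : 0 ≤ A) (g : Fin (k + 1) → ℝ) (Z : (domSys P M (k + 1)).Dom) (φ : CPair P ℂ)
    (hφ : ∀ b : PBond P 0, ‖φ.1 b‖ ≤ Real.exp (r / wt Z (blockIter (k + 1) b.src))) :
    ‖S.H g φ Z‖ ≤ A * Real.exp (-(R * (domSys P M (k + 1)).dj Z)) := by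
  rw [hS, norm_mul, norm_mul, norm_cexp_I_mul_ofReal, mul_one, Complex.norm_real, Real.norm_eq_abs, abs_of_nonneg (by positivity)]
  exact mul_le_of_le_one_right (by positivity) (norm_readout_le_one wt Z φ hφ)

/-- **W1's `Bound238` AT THE MODEL STEP** on ANY prefix set, for the model spaces. [folklore] -/
theorem bound238_u1Step (hA : 0 ≤ A) (Wk : Set (Fin (k + 1) → ℝ)) :
    S.Bound238 Wk (fun Z => {φ | ∀ b : PBond P 0, ‖φ.1 b‖ ≤ Real.exp (r / wt Z (blockIter (k + 1) b.src))}) A R :=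
  fun g _ Z φ hφ => norm_H_le S wt hS hA g Z φ hφ

/-- **THE DIFFERENCED (2.38) AT THE MODEL STEP, pointwise**: `‖H(Z; g) − H(Z; g′)‖ ≤ e^{−R d(Z)} Σ_i (A ω^{k+1−i}) |g_i − g′_i|` on `sp Z` (`A, ω ≥ 0`) — genuine,
FADING dependence on EVERY young coupling. [folklore] -/
theorem norm_H_sub_H_le (hA : 0 ≤ A) (hω : 0 ≤ ω) (g g' : Fin (k + 1) → ℝ) (Z : (domSys P M (k + 1)).Dom) (φ : CPair P ℂ)
    (hφ : ∀ b : PBond P 0, ‖φ.1 b‖ ≤ Real.exp (r / wt Z (blockIter (k + 1) b.src))) :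
    ‖S.H g φ Z - S.H g' φ Z‖ ≤ Real.exp (-(R * (domSys P M (k + 1)).dj Z)) * ∑ i : Fin (k + 1), (A * ω ^ (k + 1 - (i : ℕ))) * |g i - g' i| := by
  rw [hS, hS, ← sub_mul, ← mul_sub, norm_mul, norm_mul, Complex.norm_real, Real.norm_eq_abs, abs_of_nonneg (by positivity)]
  have hR := norm_readout_le_one wt Z φ hφ
  have hph := norm_cexp_I_sub_cexp_I_le (∑ i : Fin (k + 1), g i * ω ^ (k + 1 - (i : ℕ))) (∑ i : Fin (k + 1), g' i * ω ^ (k + 1 - (i : ℕ)))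
  have hsum := abs_sum_mul_sub_sum_mul_le g g' (fun i : Fin (k + 1) => ω ^ (k + 1 - (i : ℕ))) (fun i => pow_nonneg hω _)
  have h1 := mul_le_mul (mul_le_mul_of_nonneg_left (hph.trans hsum) (by positivity : 0 ≤ A * Real.exp (-(R * (domSys P M (k + 1)).dj Z))))
    hR (norm_nonneg _) (by positivity)
  refine h1.trans (le_of_eq ?_)
  rw [mul_one, Finset.mul_sum, Finset.mul_sum]
  exact Finset.sum_congr rfl fun i _ => by ring

/-- **W1's `YoungLipschitz` AT THE MODEL STEP** on ANY prefix set, moduli `A ω^{k+1−i}` (geometric in the AGE of the coupling). [folklore] -/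
theorem youngLipschitz_u1Step (hA : 0 ≤ A) (hω : 0 ≤ ω) (Wk : Set (Fin (k + 1) → ℝ)) :
    S.YoungLipschitz Wk (fun Z => {φ | ∀ b : PBond P 0, ‖φ.1 b‖ ≤ Real.exp (r / wt Z (blockIter (k + 1) b.src))})
      (fun i : Fin (k + 1) => A * ω ^ (k + 1 - (i : ℕ))) R :=
  fun g _ g' _ Z φ hφ => norm_H_sub_H_le S wt hS hA hω g g' Z φ hφ

/-- **ACTIVITY HOLOMORPHY ALONG THE COMPLEXIFIED READING** (the `hHhol` clause): along `Φ_X z = (b ↦ e^{i z_{b.dir, t_b}∕w_X(t_b)}, 0)` the model activity is an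
entire function of `z` (a finite sum of exponentials of continuous linear coordinates). [folklore] -/
theorem differentiableOn_H_comp_Φ (wX : Site P (k + 1) → ℝ) (g : Fin (k + 1) → ℝ) (Z : (domSys P M (k + 1)).Dom) (U : Set (Fin P.d → Site P (k + 1) → ℂ)) :
    DifferentiableOn ℂ (fun z : Fin P.d → Site P (k + 1) → ℂ =>
      S.H g ((fun b : PBond P 0 => Complex.exp (Complex.I * z b.dir (blockIter (k + 1) b.src) / (wX (blockIter (k + 1) b.src) : ℂ)), fun _ => 0)) Z) U := by
  have hcoord : ∀ (l : Fin P.d) (t : Site P (k + 1)), Differentiable ℂ fun z : Fin P.d → Site P (k + 1) → ℂ => z l t := fun l t => by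
    have h := (differentiable_apply (𝕜 := ℂ) (F' := fun _ : Site P (k + 1) => ℂ) t).comp
      (differentiable_apply (𝕜 := ℂ) (F' := fun _ : Fin P.d => Site P (k + 1) → ℂ) l)
    exact h
  have hfun : (fun z : Fin P.d → Site P (k + 1) → ℂ =>
      S.H g ((fun b : PBond P 0 => Complex.exp (Complex.I * z b.dir (blockIter (k + 1) b.src) / (wX (blockIter (k + 1) b.src) : ℂ)), fun _ => 0)) Z) =
      fun z => ((A * Real.exp (-(R * (domSys P M (k + 1)).dj Z)) : ℝ) : ℂ) *
        Complex.exp (Complex.I * ((∑ i : Fin (k + 1), g i * ω ^ (k + 1 - (i : ℕ)) : ℝ) : ℂ)) *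
        (((Fintype.card (Fin P.d × Site P (k + 1)) : ℂ))⁻¹ *
          ∑ lt : Fin P.d × Site P (k + 1), ((Real.exp (-(r / wt Z (blockIter (k + 1) (embIter (k + 1) lt.2)))) : ℝ) : ℂ) *
            Complex.exp (Complex.I * z lt.1 (blockIter (k + 1) (embIter (k + 1) lt.2)) / (wX (blockIter (k + 1) (embIter (k + 1) lt.2)) : ℂ))) := by
    funext z; rw [hS]
  have hdiv : ∀ (l : Fin P.d) (t : Site P (k + 1)),
      Differentiable ℂ fun z : Fin P.d → Site P (k + 1) → ℂ => Complex.I * z l t / (wX t : ℂ) := fun l t => by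
    have h1 : Differentiable ℂ fun z : Fin P.d → Site P (k + 1) → ℂ => Complex.I * z l t * ((wX t : ℂ))⁻¹ :=
      ((hcoord l t).const_mul Complex.I).mul_const _
    simp only [div_eq_mul_inv]
    exact h1
  rw [hfun]
  refine Differentiable.differentiableOn ((differentiable_const _).mul ((differentiable_const _).mul (Differentiable.fun_sum fun lt _ => ?_)))
  exact (differentiable_const _).mul (hdiv lt.1 _).cexp

omit hS in
/-- **THE SPACE CLAUSE** (`hΦsp`): on the ball `‖z‖ < r` the complexified reading at `X` lands in the model space of EVERY `Z ⊆ X` — the weights are monotone in the domain. [folklore] -/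
theorem Φ_mem_sp (hwt : ∀ Z t, 0 < wt Z t) (hmono : ∀ (Z X : (domSys P M (k + 1)).Dom), Z.1 ⊆ X.1 → ∀ t, wt Z t ≤ wt X t)
    (X : (domSys P M (k + 1)).Dom) {z : Fin P.d → Site P (k + 1) → ℂ} (hz : z ∈ ball (0 : Fin P.d → Site P (k + 1) → ℂ) r)
    (Z : (domSys P M (k + 1)).Dom) (hZX : Z.1 ⊆ X.1) :
    ((fun b : PBond P 0 => Complex.exp (Complex.I * z b.dir (blockIter (k + 1) b.src) / (wt X (blockIter (k + 1) b.src) : ℂ)), fun _ => (0 : ℂ)) : CPair P ℂ) ∈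
      {φ : CPair P ℂ | ∀ b : PBond P 0, ‖φ.1 b‖ ≤ Real.exp (r / wt Z (blockIter (k + 1) b.src))} := by
  intro b
  have hzn : ‖z b.dir (blockIter (k + 1) b.src)‖ ≤ r :=
    ((norm_le_pi_norm (z b.dir) _).trans (norm_le_pi_norm z _)).trans (mem_ball_zero_iff.1 hz).le
  have hr : 0 ≤ r := (norm_nonneg z).trans (mem_ball_zero_iff.1 hz).le
  refine (norm_cexp_I_mul_div_le (hwt X _) hzn).trans (Real.exp_le_exp.2 ?_)
  exact div_le_div_of_nonneg_left hr (hwt Z _) (hmono Z X hZX _)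

omit hS in
/-- **THE COMPLEXIFICATION `ι_X B = ((l,t) ↦ B_{l,t}·w_X(t))` IS INJECTIVE** (`w_X > 0`): an honest complexification of the probe fields, not the zero map. [folklore] -/
theorem ι_injective (wX : Site P (k + 1) → ℝ) (hwX : ∀ t, 0 < wX t) :
    Function.Injective (fun B : Fin P.d → Site P (k + 1) → ℝ => fun l t => ((B l t : ℝ) : ℂ) * (wX t : ℂ)) := by
  intro B B' h
  funext l t
  have h1 := congrFun (congrFun h l) t
  have hw : (wX t : ℂ) ≠ 0 := Complex.ofReal_ne_zero.2 (hwX t).ne'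
  exact_mod_cast mul_right_cancel₀ hw h1

omit hS in
/-- **THE CHART CLAUSE** (`hΦemb`): on real probe fields the complexified reading IS the model reading of the exponentiated chart — `Φ_X (ι_X B) = emb (e^{iB})`,
`(ι_X B)_{l,t} = B_{l,t}·w_X(t)`, chart `ρ x = ix` (`w_X > 0`). [folklore] -/
theorem Φ_ι_eq (wX : Site P (k + 1) → ℝ) (hwX : ∀ t, 0 < wX t) (B : Fin P.d → Site P (k + 1) → ℝ) :
    ((fun b : PBond P 0 => Complex.exp (Complex.I * (fun l t => ((B l t : ℝ) : ℂ) * (wX t : ℂ)) b.dir (blockIter (k + 1) b.src) /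
        (wX (blockIter (k + 1) b.src) : ℂ)), fun _ => (0 : ℂ)) : CPair P ℂ) =
      ((fun b : PBond P 0 => (fun l t => NormedSpace.exp (((ContinuousLinearMap.id ℝ ℝ).smulRight Complex.I) (B l t))) b.dir (blockIter (k + 1) b.src)),
        fun _ => (0 : ℂ)) := by
  refine Prod.ext (funext fun b => ?_) rfl
  have hw : (wX (blockIter (k + 1) b.src) : ℂ) ≠ 0 := Complex.ofReal_ne_zero.2 (hwX _).ne'
  simp only [ContinuousLinearMap.smulRight_apply, ContinuousLinearMap.id_apply, Complex.real_smul]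
  rw [← congrFun Complex.exp_eq_exp_ℂ, ← mul_assoc, mul_div_assoc, div_self hw, mul_one, mul_comm]

omit hS in
/-- **THE SITE-WEIGHT CLAUSE** (`hw`): the complexification of a unit probe field at `(l, t)` has sup norm `≤ w_X(t)` (`w_X ≥ 0`; basis `Basis.singleton`, `bV c = 1`). [folklore] -/
theorem norm_ι_single_le [DecidableEq (Fin P.d)] [DecidableEq (Site P (k + 1))] (wX : Site P (k + 1) → ℝ) (hwX : ∀ t, 0 ≤ wX t)
    (l : Fin P.d) (t : Site P (k + 1)) (c : Unit) :
    ‖(fun l' t' => (((Pi.single l (Pi.single t ((Module.Basis.singleton Unit ℝ) c)) : Fin P.d → Site P (k + 1) → ℝ) l' t' : ℝ) : ℂ) * (wX t' : ℂ))‖ ≤ wX t := by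
  refine (pi_norm_le_iff_of_nonneg (hwX t)).2 fun l' => (pi_norm_le_iff_of_nonneg (hwX t)).2 fun t' => ?_
  rw [Module.Basis.singleton_apply]
  by_cases hl : l' = l
  · subst hl
    by_cases ht : t' = t
    · subst ht
      simp [abs_of_nonneg (hwX t')]
    · simp [Pi.single_eq_of_ne ht, hwX]
  · simp [Pi.single_eq_of_ne hl, hwX]

/-- **NON-DEGENERACY I — the activities read the configuration**: at the zero configuration `H(Z; g; 0) = 0` … [folklore] -/
theorem H_zero_config (g : Fin (k + 1) → ℝ) (Z : (domSys P M (k + 1)).Dom) : S.H g (0 : CPair P ℂ) Z = 0 := by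
  rw [hS]; simp

/-- … while at the unit configuration `𝟙 = (1, 0)` the activity has modulus `A e^{−R d(Z)} · avg e^{−r∕w} > 0` (`A > 0`, a coarse site exists): the localized sum genuinely
DEPENDS on the probe-read configuration (contrast: the empty towers of (C) p607185, the configuration-constant phase tower of dag-n22-w1 p611030). [folklore] -/
theorem norm_H_one_config_pos [Nonempty (Fin P.d × Site P (k + 1))] (hA : 0 < A) (g : Fin (k + 1) → ℝ) (Z : (domSys P M (k + 1)).Dom) :
    0 < ‖S.H g ((fun _ => (1 : ℂ)), fun _ => (0 : ℂ)) Z‖ := by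
  rw [hS, norm_mul, norm_mul, norm_cexp_I_mul_ofReal, mul_one, Complex.norm_real, Real.norm_eq_abs, abs_of_pos (by positivity), norm_mul,
    norm_inv, Complex.norm_natCast]
  refine mul_pos (by positivity) (mul_pos (inv_pos.2 (by exact_mod_cast Fintype.card_pos)) ?_)
  have hre : (∑ lt : Fin P.d × Site P (k + 1), ((Real.exp (-(r / wt Z (blockIter (k + 1) (embIter (k + 1) lt.2)))) : ℝ) : ℂ) * (1 : ℂ)) =
      ((∑ lt : Fin P.d × Site P (k + 1), Real.exp (-(r / wt Z (blockIter (k + 1) (embIter (k + 1) lt.2)))) : ℝ) : ℂ) := by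
    push_cast; simp
  rw [hre, Complex.norm_real, Real.norm_eq_abs, abs_of_pos (Finset.sum_pos (fun _ _ => Real.exp_pos _) Finset.univ_nonempty)]
  exact Finset.sum_pos (fun _ _ => Real.exp_pos _) Finset.univ_nonempty

/-- **NON-DEGENERACY II — the activities read the history**: freezing all couplings but `i`, `H(Z; g|g_i := s) = H(Z; g|g_i := 0)·e^{i s ω^{k+1−i}}` — a genuine phase
in EVERY young coupling, fading with its age when `ω < 1`. [folklore] -/
theorem H_update (g : Fin (k + 1) → ℝ) (φ : CPair P ℂ) (Z : (domSys P M (k + 1)).Dom) (i : Fin (k + 1)) (s : ℝ) :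
    S.H (Function.update g i s) φ Z = S.H (Function.update g i 0) φ Z * Complex.exp (Complex.I * ((s * ω ^ (k + 1 - (i : ℕ)) : ℝ) : ℂ)) := by
  have hsum : ∀ u : ℝ, ∑ j : Fin (k + 1), Function.update g i u j * ω ^ (k + 1 - (j : ℕ)) =
      ∑ j : Fin (k + 1), Function.update g i 0 j * ω ^ (k + 1 - (j : ℕ)) + u * ω ^ (k + 1 - (i : ℕ)) := fun u => by
    classical
    rw [← Finset.sum_erase_add Finset.univ _ (Finset.mem_univ i), ← Finset.sum_erase_add Finset.univ (fun j => Function.update g i 0 j * _) (Finset.mem_univ i)]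
    simp only [Function.update_self, zero_mul, add_zero]
    congr 1
    exact Finset.sum_congr rfl fun j hj => by rw [Function.update_of_ne (Finset.ne_of_mem_erase hj), Function.update_of_ne (Finset.ne_of_mem_erase hj)]
  rw [hS, hS, hsum s, Complex.ofReal_add, mul_add, Complex.exp_add]
  ring

end Step

end YMDAG.N22.WindowSoftTwoPoint.NonzeroChart

end
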